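import Mathlib
import HarnessLib
import Literature.Analysis.FluidPDE.Tao2016AveragedNS.LocalCascadeSolutions
import Literature.Analysis.FluidPDE.Tao2016AveragedNS.RenormalisedCascadeWaves
import Literature.Analysis.FluidPDE.Tao2016AveragedNS.ViscousEternalSolutions
import Literature.Analysis.FluidPDE.Tao2016AveragedNS.BoundedEternalSolutions
import Summits.NavierStokesRegularity.NavierStokesRegularity.Theses.TaoLadderRungTwoBreak
import Summits.NavierStokesRegularity.NavierStokesRegularity.Theorems.TaoLadderRungTwoBreakNoSurvivingEternalViscBddOneSmallActionRung

/-!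
# The TAIL CONVEYOR of K1ᵛ(1) `TaoLadderRungTwoBreak.NoSurvivingEternalViscBddOne` (stmt-NavierStokesRegularity-20419)

MODEL lattice ODEs only (Tao 2016 §4, §6.4; cell vocabulary `IsEternalVisc`, `UniformBound`, `physEnergy`, `physFlux`,
`EternalSurvivingFwd`); nothing here is a statement about the Navier–Stokes equations; no summit, crux or rung LEAF is
proved (`--supports stmt-NavierStokesRegularity-20419`).  Sequel to `…SmallActionRung` (conveyor inequality with a UNIFORM
action budget).  Here the finite tails `E_{k+1} + ⋯ + E_{k+j}` (tree `hasDerivAt_tail`) are integrated from the far past: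
interior fluxes telescope, dissipation has a sign, the top boundary flux is `O(Λ^{-2(k+j)}e^{2σ})` by the uniform bound and
is sent to `j → ∞`; what remains is the traffic through the ONE bond `k → k+1`, controlled by the action
`a_k = ∫‖W_{k+1}‖` of the single shell `k+1`.  Results: `tailSum_le` (TAIL CONVEYOR
`E_{k+1}(σ)+⋯+E_{k+j}(σ) ≤ 2C_AΛ⁻¹·a_k·sup E_k`), `tsum_tail_le`, `physEnergy_succ_le_bond` (bond efficiency `≤ 2C_AΛ⁻¹a_k`,
no `κ/(1−κ)`, no uniform budget), `physEnergy_le_prod` (chain `sup E_n ≤ (∏_{k<n}2C_AΛ⁻¹a_k)·sup E_0`),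
`not_survivingFwd_of_tendsto_bondProducts` (survival ⇒ `(1+ε₀)ⁿ∏_{k<n}2C_AΛ⁻¹a_k ↛ 0`),
`frequently_largeAction_of_survivingFwd` / `frequently_action_gt_of_survivingFwd` (**a surviving bounded admissible eternal
solution has, for every `θ < 1`, INFINITELY MANY shells with action `> θΛ/(2C_A(1+ε₀)) ≥ θ/(128(1+ε₀))`**),
`not_survivingFwd_of_eventually_smallAction` / `noSurvivingEternalViscBdd_rung_tailSmallAction` (an EVENTUAL bond budget
`(1+ε₀)·2C_AΛ⁻¹a_k ≤ θ < 1` excludes survival; uniform budget `1/300` at `εs = 1` — the small-action rung had `1/400` and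
`(2+ε₀)κ < 1`).  HONEST LABEL: incremental per-bond bookkeeping of the K1 wall; the wall itself (why a bounded front on a
fixed-spread table cannot keep paying `≳ Λ/(2C_A)` action per bond while shedding `< ε₀` energy per bond) is untouched;
(ρ0), (ρ+), ⟨20419⟩ and every NS statement remain OPEN.
-/

noncomputable section

-- the summit and its single sub-problem share the name (CONVENTIONS §1)
set_option linter.dupNamespace false

namespace Summit.NavierStokesRegularity.NavierStokesRegularity.Theorems.NoSurvivingEternalViscBddOne.TailConveyor

open Set Filter Topology MeasureTheory
open scoped RealInnerProductSpace
open Literature.Analysis.FluidPDE Literature.Analysis.FluidPDE.TaoCascade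
open Summit.NavierStokesRegularity.NavierStokesRegularity.Theses.TaoLadderRungTwoBreak
open Summit.NavierStokesRegularity.NavierStokesRegularity.Theorems.NoSurvivingEternalViscBddOne.SmallAction

variable {m : ℕ} {ε₀ νh : ℝ} {α : Fin m → Fin m → Fin m → ℤ × ℤ × ℤ → ℝ} {W : ℤ → ℝ → Em m}

/-! ## The finite tail on a log-time interval -/

/-- Splitting of the scale weight of the top shell of a tail: `Λ^{-2(k+j)} = Λ^{-2k} · (Λ^{-2})^{j}`.
[cite: Tao2016AveragedNS, §4 (4.1); elementary] -/
theorem zpow_inv_sq_split (hΛ : bigLam ε₀ ≠ 0) (k : ℤ) (j : ℕ) :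
    (bigLam ε₀ ^ (k + j))⁻¹ ^ 2 = (bigLam ε₀ ^ k)⁻¹ ^ 2 * ((bigLam ε₀)⁻¹ ^ 2) ^ j := by
  rw [zpow_add₀ hΛ, zpow_natCast, mul_inv, mul_pow]
  congr 1
  rw [← inv_pow]
  ring

/-- **The finite tail on `[s₀, σ]`**: with `‖W‖ ≤ B`, uniform action budget `M`, `E_k ≤ A` always and bond action
`∫‖W_{k+1}‖ ≤ a`: `Σ_{i<j} E_{k+1+i}(σ) ≤ Σ_{i<j} E_{k+1+i}(s₀) + 2C_AΛ⁻¹·a·A + 2C_AΛ⁻¹·M·Λ^{-2(k+j)}B²e^{2σ}` (traffic through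
the bond `k → k+1` plus the small traffic through the top bond; interior fluxes telescope, dissipation only helps).
[cite: Tao2016AveragedNS, §4 Lemma 4.1 (4.8)–(4.10) with (4.3), the viscous equation before Thm. 4.2, §6.4; tree `hasDerivAt_tail`, `abs_physFlux_le`] -/
theorem tailSum_step (hε : 0 < ε₀) (hW : IsEternalVisc ε₀ νh α W) (hc : IsCancellingCoeff α)
    {B : ℝ} (hB : ∀ k σ, ‖W k σ‖ ≤ B) {M : ℝ} (hint : ∀ n, Integrable (fun σ => ‖W n σ‖))
    (hM : ∀ n, ∫ σ, ‖W n σ‖ ≤ M) {k : ℤ} {A a : ℝ}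
    (hA : ∀ σ, physEnergy ε₀ W k σ ≤ A) (ha : ∫ σ, ‖W (k + 1) σ‖ ≤ a) (j : ℕ) {s₀ σ : ℝ} (hle : s₀ ≤ σ) :
    ∑ i ∈ Finset.range j, physEnergy ε₀ W (k + 1 + i) σ
      ≤ ∑ i ∈ Finset.range j, physEnergy ε₀ W (k + 1 + i) s₀
        + 2 * fluxConst α * (bigLam ε₀)⁻¹ * a * A
        + 2 * fluxConst α * (bigLam ε₀)⁻¹ * M * ((bigLam ε₀ ^ (k + j))⁻¹ ^ 2 * B ^ 2 * Real.exp (2 * σ)) := by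
  set κ₀ := 2 * fluxConst α * (bigLam ε₀)⁻¹ with hκ₀
  have hΛ : 0 < bigLam ε₀ := bigLam_pos (by linarith)
  have hκ₀nn : 0 ≤ κ₀ := by have := fluxConst_nonneg α; positivity
  have hA0 : 0 ≤ A := (physEnergy_nonneg ε₀ W k 0).trans (hA 0)
  set S : ℝ := (bigLam ε₀ ^ (k + j))⁻¹ ^ 2 * B ^ 2 * Real.exp (2 * σ) with hS
  have hS0 : 0 ≤ S := by positivity
  have hSle : ∀ s, s ≤ σ → physEnergy ε₀ W (k + j) s ≤ S := by
    intro s hs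
    refine (physEnergy_le_exp hε hB (k + j) s).trans ?_
    exact mul_le_mul_of_nonneg_left (Real.exp_le_exp.2 (by linarith)) (by positivity)
  set T : ℝ → ℝ := fun x => ∑ i ∈ Finset.range j, physEnergy ε₀ W (k + 1 + i) x with hT
  set D : ℝ → ℝ := fun s => physFlux ε₀ α W k s - physFlux ε₀ α W (k + j) s
      - ∑ i ∈ Finset.range j, 2 * viscCoef ε₀ νh (k + 1 + i) s * physEnergy ε₀ W (k + 1 + i) s with hD
  have hderiv : ∀ s, HasDerivAt T (D s) s := fun s => hasDerivAt_tail hε hW hc k j s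
  have hWcont : ∀ n : ℤ, Continuous (W n) := fun n =>
    continuous_iff_continuousAt.2 fun σ' => (hW.law n σ').continuousAt
  have hDcont : Continuous D := by
    have h1 := continuous_physFlux hW hc k
    have h2 := continuous_physFlux hW hc (k + j)
    have h3 : Continuous fun s => ∑ i ∈ Finset.range j,
        2 * viscCoef ε₀ νh (k + 1 + i) s * physEnergy ε₀ W (k + 1 + i) s := by
      refine continuous_finsetSum _ fun i _ => ?_
      have h4 : Continuous fun s => viscCoef ε₀ νh (k + 1 + i) s := by unfold viscCoef; fun_prop
      have h5 := continuous_physEnergy hW (k + 1 + i)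
      fun_prop
    simp only [hD]; fun_prop
  set G : ℝ → ℝ := fun s => κ₀ * A * ‖W (k + 1) s‖ + κ₀ * S * ‖W (k + j + 1) s‖ with hG
  have hGcont : Continuous G := by
    have h1 := (hWcont (k + 1)).norm
    have h2 := (hWcont (k + j + 1)).norm
    simp only [hG]; fun_prop
  have hDG : ∀ s ∈ Icc s₀ σ, D s ≤ G s := by
    intro s hs
    have hF1 := (le_abs_self _).trans (abs_physFlux_le hε hc W k s)
    have hF2 := (neg_le_abs _).trans (abs_physFlux_le hε hc W (k + j) s)
    have hvis : 0 ≤ ∑ i ∈ Finset.range j,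
        2 * viscCoef ε₀ νh (k + 1 + i) s * physEnergy ε₀ W (k + 1 + i) s :=
      Finset.sum_nonneg fun i _ =>
        mul_nonneg (mul_nonneg two_pos.le (viscCoef_nonneg hε hW.nonneg _ _)) (physEnergy_nonneg ε₀ W _ s)
    have hb1 : κ₀ * ‖W (k + 1) s‖ * physEnergy ε₀ W k s ≤ κ₀ * ‖W (k + 1) s‖ * A :=
      mul_le_mul_of_nonneg_left (hA s) (mul_nonneg hκ₀nn (norm_nonneg (W (k + 1) s)))
    have hb2 : κ₀ * ‖W (k + j + 1) s‖ * physEnergy ε₀ W (k + j) s ≤ κ₀ * ‖W (k + j + 1) s‖ * S :=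
      mul_le_mul_of_nonneg_left (hSle s hs.2) (mul_nonneg hκ₀nn (norm_nonneg (W (k + j + 1) s)))
    simp only [hD, hG]
    rw [hκ₀] at hb1 hb2 ⊢
    linarith
  have hftc : ∫ s in s₀..σ, D s = T σ - T s₀ :=
    intervalIntegral.integral_eq_sub_of_hasDerivAt (fun s _ => hderiv s) (hDcont.intervalIntegrable _ _)
  have hmono : ∫ s in s₀..σ, D s ≤ ∫ s in s₀..σ, G s :=
    intervalIntegral.integral_mono_on hle (hDcont.intervalIntegrable _ _) (hGcont.intervalIntegrable _ _)
      fun s hs => hDG s hs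
  have hpart : ∀ n : ℤ, ∫ s in s₀..σ, ‖W n s‖ ≤ ∫ s, ‖W n s‖ := by
    intro n
    rw [intervalIntegral.integral_of_le hle]
    exact setIntegral_le_integral (hint n) (Eventually.of_forall fun s => norm_nonneg _)
  have hGint : ∫ s in s₀..σ, G s
      = κ₀ * A * (∫ s in s₀..σ, ‖W (k + 1) s‖) + κ₀ * S * (∫ s in s₀..σ, ‖W (k + j + 1) s‖) := by
    simp only [hG]
    rw [intervalIntegral.integral_add (((hWcont (k + 1)).norm.intervalIntegrable _ _).const_mul _)
      (((hWcont (k + j + 1)).norm.intervalIntegrable _ _).const_mul _),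
      intervalIntegral.integral_const_mul, intervalIntegral.integral_const_mul]
  have hGle : ∫ s in s₀..σ, G s ≤ κ₀ * a * A + κ₀ * M * S := by
    rw [hGint]
    have h1 := mul_le_mul_of_nonneg_left ((hpart (k + 1)).trans ha) (mul_nonneg hκ₀nn hA0)
    have h2 := mul_le_mul_of_nonneg_left ((hpart (k + j + 1)).trans (hM (k + j + 1))) (mul_nonneg hκ₀nn hS0)
    linarith
  have hTdef : ∀ x, T x = ∑ i ∈ Finset.range j, physEnergy ε₀ W (k + 1 + i) x := fun x => rfl
  rw [← hTdef σ, ← hTdef s₀, hκ₀] at *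
  linarith

/-! ## The tail conveyor -/

/-- **THE TAIL CONVEYOR.**  For a uniformly bounded admissible eternal solution (any `ν̂ ≥ 0`) of a cancelling table at
`ε₀ > 0`: `E_k ≤ A` always and bond action `∫‖W_{k+1}‖ ≤ a` give `E_{k+1}(σ) + ⋯ + E_{k+j}(σ) ≤ 2C_AΛ⁻¹·a·A` for every
`j` and `σ` — everything above shell `k` came through the bond `k → k+1`.
[cite: Tao2016AveragedNS, §4 Lemma 4.1 (4.8)–(4.10) with (4.3), the viscous equation before Thm. 4.2, §6.4; this file] -/
theorem tailSum_le (hε : 0 < ε₀) (hW : IsEternalVisc ε₀ νh α W) (hc : IsCancellingCoeff α) (hU : UniformBound W)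
    {k : ℤ} {A a : ℝ} (hA : ∀ σ, physEnergy ε₀ W k σ ≤ A) (ha : ∫ σ, ‖W (k + 1) σ‖ ≤ a) :
    ∀ (j : ℕ) (σ : ℝ), ∑ i ∈ Finset.range j, physEnergy ε₀ W (k + 1 + i) σ ≤ 2 * fluxConst α * (bigLam ε₀)⁻¹ * a * A := by
  obtain ⟨B, hB⟩ := hU
  obtain ⟨M, hM⟩ := hW.action
  have hint : ∀ n, Integrable (fun σ => ‖W n σ‖) := fun n => (hM n).1
  have hM' : ∀ n, ∫ σ, ‖W n σ‖ ≤ M := fun n => (hM n).2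
  set κ₀ := 2 * fluxConst α * (bigLam ε₀)⁻¹ with hκ₀
  have hΛ : 0 < bigLam ε₀ := bigLam_pos (by linarith)
  have hΛ1 : 1 < bigLam ε₀ := by unfold bigLam; exact Real.one_lt_rpow (by linarith) (by norm_num)
  have hκ₀nn : 0 ≤ κ₀ := by have := fluxConst_nonneg α; positivity
  have hM0 : 0 ≤ M := le_trans (integral_nonneg fun σ => norm_nonneg (W 0 σ)) (hM' 0)
  have hstepA : ∀ (j : ℕ) (σ : ℝ), ∑ i ∈ Finset.range j, physEnergy ε₀ W (k + 1 + i) σ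
      ≤ κ₀ * a * A + κ₀ * M * ((bigLam ε₀ ^ (k + j))⁻¹ ^ 2 * B ^ 2 * Real.exp (2 * σ)) := by
    intro j σ
    have hlim : Tendsto (fun s₀ => ∑ i ∈ Finset.range j, physEnergy ε₀ W (k + 1 + i) s₀) atBot (𝓝 0) := by
      have h := tendsto_finsetSum (Finset.range j)
        (fun i _ => tendsto_physEnergy_atBot hε ⟨B, hB⟩ (k + 1 + (i : ℤ)))
      rwa [Finset.sum_const_zero] at h
    refine le_of_forall_pos_lt_add fun δ hδ => ?_
    have hev : ∀ᶠ s₀ in atBot, ∑ i ∈ Finset.range j, physEnergy ε₀ W (k + 1 + i) s₀ < δ :=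
      (tendsto_order.1 hlim).2 δ hδ
    obtain ⟨s₀, hs₀⟩ := (hev.and (eventually_le_atBot σ)).exists
    have := tailSum_step hε hW hc hB hint hM' hA ha j hs₀.2
    rw [← hκ₀] at this
    linarith [hs₀.1]
  intro j σ
  set q : ℝ := (bigLam ε₀)⁻¹ ^ 2 with hq
  have hq0 : 0 ≤ q := by positivity
  have hq1 : q < 1 := by
    have : (bigLam ε₀)⁻¹ < 1 := inv_lt_one_of_one_lt₀ hΛ1
    have h0 : 0 ≤ (bigLam ε₀)⁻¹ := inv_nonneg.2 hΛ.le
    rw [hq]; nlinarith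
  set c₀ : ℝ := κ₀ * M * ((bigLam ε₀ ^ k)⁻¹ ^ 2 * B ^ 2 * Real.exp (2 * σ)) with hc₀
  have hc₀nn : 0 ≤ c₀ := by positivity
  have hbig : ∀ j' : ℕ, j ≤ j' →
      ∑ i ∈ Finset.range j, physEnergy ε₀ W (k + 1 + i) σ ≤ κ₀ * a * A + c₀ * q ^ j' := by
    intro j' hjj'
    have hsub : ∑ i ∈ Finset.range j, physEnergy ε₀ W (k + 1 + i) σ
        ≤ ∑ i ∈ Finset.range j', physEnergy ε₀ W (k + 1 + i) σ :=
      Finset.sum_le_sum_of_subset_of_nonneg (Finset.range_mono hjj') fun i _ _ => physEnergy_nonneg ε₀ W _ σ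
    have h := hstepA j' σ
    rw [zpow_inv_sq_split hΛ.ne' k j'] at h
    have : κ₀ * M * ((bigLam ε₀ ^ k)⁻¹ ^ 2 * q ^ j' * B ^ 2 * Real.exp (2 * σ)) = c₀ * q ^ j' := by rw [hc₀]; ring
    rw [← hq, this] at h
    exact hsub.trans h
  refine le_of_forall_pos_lt_add fun δ hδ => ?_
  have ht : Tendsto (fun j' : ℕ => c₀ * q ^ j') atTop (𝓝 (c₀ * 0)) :=
    (tendsto_pow_atTop_nhds_zero_of_lt_one hq0 hq1).const_mul c₀
  rw [mul_zero] at ht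
  obtain ⟨j', hj'⟩ := ((ht.eventually (gt_mem_nhds hδ)).and (eventually_ge_atTop j)).exists
  have := hbig j' hj'.2
  rw [hκ₀] at this
  linarith [hj'.1]

/-- **The whole tail is summable and bounded by the bond**: `Σ_{i≥0} E_{k+1+i}(σ) ≤ 2C_AΛ⁻¹·a·A` at every log-time.
[cite: Tao2016AveragedNS, §4 Lemma 4.1 (4.8)–(4.10), §6.4; this file] -/
theorem tsum_tail_le (hε : 0 < ε₀) (hW : IsEternalVisc ε₀ νh α W) (hc : IsCancellingCoeff α) (hU : UniformBound W)
    {k : ℤ} {A a : ℝ} (hA : ∀ σ, physEnergy ε₀ W k σ ≤ A) (ha : ∫ σ, ‖W (k + 1) σ‖ ≤ a) (σ : ℝ) :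
    Summable (fun i : ℕ => physEnergy ε₀ W (k + 1 + i) σ) ∧
      ∑' i : ℕ, physEnergy ε₀ W (k + 1 + i) σ ≤ 2 * fluxConst α * (bigLam ε₀)⁻¹ * a * A := by
  have h := fun j => tailSum_le hε hW hc hU hA ha j σ
  have h0 : ∀ i : ℕ, 0 ≤ physEnergy ε₀ W (k + 1 + i) σ := fun i => physEnergy_nonneg ε₀ W _ σ
  exact ⟨summable_of_sum_range_le h0 h, Real.tsum_le_of_sum_range_le h0 h⟩

/-- **The bond efficiency**: `E_k ≤ A` at all log-times and `∫‖W_{k+1}‖ ≤ a` give `E_{k+1} ≤ 2C_AΛ⁻¹·a·A` at all log-times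
(no uniform budget, no `κ/(1−κ)`).
[cite: Tao2016AveragedNS, §4 Lemma 4.1 (4.8)–(4.10), §6.4; this file] -/
theorem physEnergy_succ_le_bond (hε : 0 < ε₀) (hW : IsEternalVisc ε₀ νh α W) (hc : IsCancellingCoeff α)
    (hU : UniformBound W) {k : ℤ} {A a : ℝ} (hA : ∀ σ, physEnergy ε₀ W k σ ≤ A)
    (ha : ∫ σ, ‖W (k + 1) σ‖ ≤ a) : ∀ σ, physEnergy ε₀ W (k + 1) σ ≤ 2 * fluxConst α * (bigLam ε₀)⁻¹ * a * A := by
  intro σ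
  have h := tailSum_le hε hW hc hU hA ha 1 σ
  simpa using h

/-! ## The chain form and survival -/

/-- **The chain form**: with bond actions `∫‖W_{n+1}‖ ≤ a_n` (`n ∈ ℕ`) and `E_0 ≤ A₀` at all log-times,
`E_n ≤ (∏_{i<n} 2C_AΛ⁻¹a_i) · A₀` at all log-times.
[cite: Tao2016AveragedNS, §4 Lemma 4.1 (4.8)–(4.10), §6.4; this file] -/
theorem physEnergy_le_prod (hε : 0 < ε₀) (hW : IsEternalVisc ε₀ νh α W) (hc : IsCancellingCoeff α)
    (hU : UniformBound W) {a : ℕ → ℝ} (ha : ∀ n : ℕ, ∫ σ, ‖W ((n : ℤ) + 1) σ‖ ≤ a n) {A₀ : ℝ}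
    (hA₀ : ∀ σ, physEnergy ε₀ W 0 σ ≤ A₀) :
    ∀ (n : ℕ) (σ : ℝ), physEnergy ε₀ W n σ
      ≤ (∏ i ∈ Finset.range n, 2 * fluxConst α * (bigLam ε₀)⁻¹ * a i) * A₀ := by
  intro n
  induction n with
  | zero => intro σ; simpa using hA₀ σ
  | succ n ih =>
    intro σ
    have h := physEnergy_succ_le_bond hε hW hc hU (k := (n : ℤ)) ih (ha n) σ
    rw [show ((n + 1 : ℕ) : ℤ) = (n : ℤ) + 1 by push_cast; ring, Finset.prod_range_succ]
    calc physEnergy ε₀ W ((n : ℤ) + 1) σ ≤ _ := h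
      _ = _ := by ring

/-- **Survival forces non-vanishing weighted bond products.**  If the bond actions `∫‖W_{n+1}‖ ≤ a_n` make
`(1+ε₀)ⁿ · ∏_{i<n} 2C_AΛ⁻¹a_i → 0`, the solution is NOT forward (S₁)-surviving.
[cite: Tao2016AveragedNS, §4 Lemma 4.1 (4.8)–(4.10), the viscous equation before Thm. 4.2, §6.4; this file] -/
theorem not_survivingFwd_of_tendsto_bondProducts (hε : 0 < ε₀) (hW : IsEternalVisc ε₀ νh α W)
    (hc : IsCancellingCoeff α) (hU : UniformBound W) {a : ℕ → ℝ}
    (ha : ∀ n : ℕ, ∫ σ, ‖W ((n : ℤ) + 1) σ‖ ≤ a n)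
    (hlim : Tendsto (fun n : ℕ => (1 + ε₀) ^ n * ∏ i ∈ Finset.range n, 2 * fluxConst α * (bigLam ε₀)⁻¹ * a i)
      atTop (𝓝 0)) :
    ¬ EternalSurvivingFwd 1 ε₀ W := by
  obtain ⟨A₀, hA₀⟩ := exists_physEnergy_le hε hW hU 0
  have hprod := physEnergy_le_prod hε hW hc hU ha hA₀
  rintro ⟨c, hc0, hcN⟩
  have ht : Tendsto (fun n : ℕ => ((1 + ε₀) ^ n * ∏ i ∈ Finset.range n,
      2 * fluxConst α * (bigLam ε₀)⁻¹ * a i) * A₀) atTop (𝓝 (0 * A₀)) := hlim.mul_const A₀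
  rw [zero_mul] at ht
  obtain ⟨N, hN⟩ := eventually_atTop.1 (ht.eventually (gt_mem_nhds hc0))
  obtain ⟨n, hnN, σ, -, hcle⟩ := hcN N
  have hw : physWeight 1 ε₀ ^ n * (Real.exp (2 * σ) * ‖W n σ‖ ^ 2) = (1 + ε₀) ^ n * physEnergy ε₀ W n σ := by
    have := wtEnergy_eq hε W n σ; unfold wtEnergy at this; exact this
  rw [hw] at hcle
  have hb : (1 + ε₀) ^ n * physEnergy ε₀ W n σ
      ≤ ((1 + ε₀) ^ n * ∏ i ∈ Finset.range n, 2 * fluxConst α * (bigLam ε₀)⁻¹ * a i) * A₀ := by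
    rw [mul_assoc]
    exact mul_le_mul_of_nonneg_left (hprod n σ) (by positivity)
  linarith [hN n hnN]

/-- **An EVENTUAL bond-action budget excludes survival**: if `(1+ε₀)·2C_AΛ⁻¹·a_n ≤ θ < 1` for all `n ≥ K` (the first `K`
bonds arbitrary, `a_n ≥ 0`), the solution is not forward (S₁)-surviving.
[cite: Tao2016AveragedNS, §4 Lemma 4.1 (4.8)–(4.10), the viscous equation before Thm. 4.2, §6.4; this file] -/
theorem not_survivingFwd_of_eventually_smallAction (hε : 0 < ε₀) (hW : IsEternalVisc ε₀ νh α W)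
    (hc : IsCancellingCoeff α) (hU : UniformBound W) {a : ℕ → ℝ} (ha0 : ∀ n, 0 ≤ a n)
    (ha : ∀ n : ℕ, ∫ σ, ‖W ((n : ℤ) + 1) σ‖ ≤ a n) {K : ℕ} {θ : ℝ} (hθ : θ < 1)
    (hsmall : ∀ n, K ≤ n → (1 + ε₀) * (2 * fluxConst α * (bigLam ε₀)⁻¹ * a n) ≤ θ) :
    ¬ EternalSurvivingFwd 1 ε₀ W := by
  set κ₀ := 2 * fluxConst α * (bigLam ε₀)⁻¹ with hκ₀
  have hΛ : 0 < bigLam ε₀ := bigLam_pos (by linarith)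
  have hκ₀nn : 0 ≤ κ₀ := by have := fluxConst_nonneg α; positivity
  set b : ℕ → ℝ := fun n => (1 + ε₀) ^ n * ∏ i ∈ Finset.range n, κ₀ * a i with hb
  have hb0 : ∀ n, 0 ≤ b n := fun n => by
    have : 0 ≤ ∏ i ∈ Finset.range n, κ₀ * a i := Finset.prod_nonneg fun i _ => mul_nonneg hκ₀nn (ha0 i)
    positivity
  have hθ0 : 0 ≤ θ := le_trans (by have := ha0 K; positivity) (hsmall K le_rfl)
  have hbsucc : ∀ n, b (n + 1) = b n * ((1 + ε₀) * (κ₀ * a n)) := by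
    intro n; simp only [hb]; rw [Finset.prod_range_succ, pow_succ]; ring
  -- geometric decay beyond `K`
  have hdecay : ∀ d : ℕ, b (K + d) ≤ b K * θ ^ d := by
    intro d
    induction d with
    | zero => simp
    | succ d ih =>
      have h1 : (1 + ε₀) * (κ₀ * a (K + d)) ≤ θ := hsmall (K + d) (Nat.le_add_right _ _)
      have h2 : 0 ≤ (1 + ε₀) * (κ₀ * a (K + d)) := by have := ha0 (K + d); positivity
      have e : b (K + (d + 1)) = b (K + d) * ((1 + ε₀) * (κ₀ * a (K + d))) := by rw [← add_assoc, hbsucc]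
      rw [e, pow_succ]
      calc b (K + d) * ((1 + ε₀) * (κ₀ * a (K + d))) ≤ b K * θ ^ d * ((1 + ε₀) * (κ₀ * a (K + d))) :=
            mul_le_mul_of_nonneg_right ih h2
        _ ≤ b K * θ ^ d * θ := mul_le_mul_of_nonneg_left h1 (mul_nonneg (hb0 K) (pow_nonneg hθ0 d))
        _ = b K * (θ ^ d * θ) := by ring
  have hlim : Tendsto b atTop (𝓝 0) := by
    have hg : Tendsto (fun n : ℕ => b K * θ ^ (n - K)) atTop (𝓝 (b K * 0)) :=
      ((tendsto_pow_atTop_nhds_zero_of_lt_one hθ0 hθ).comp (tendsto_sub_atTop_nat K)).const_mul (b K)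
    rw [mul_zero] at hg
    refine tendsto_of_tendsto_of_tendsto_of_le_of_le' tendsto_const_nhds hg
      (Eventually.of_forall hb0) ?_
    refine (eventually_ge_atTop K).mono fun n hn => ?_
    have h := hdecay (n - K)
    rwa [Nat.add_sub_cancel' hn] at h
  exact not_survivingFwd_of_tendsto_bondProducts hε hW hc hU ha hlim

/-- **SURVIVAL FORCES INFINITELY MANY EXPENSIVE BONDS.**  If a uniformly bounded admissible eternal solution (any `ν̂ ≥ 0`) of
a cancelling table is forward (S₁)-surviving, then for every `θ < 1` there are INFINITELY MANY shells `n` whose successor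
carries action `∫‖W_{n+1}‖ > θ·Λ/(2C_A(1+ε₀))` (stated as `θ < (1+ε₀)·2C_AΛ⁻¹·∫‖W_{n+1}‖` frequently along `n → ∞`).
[cite: Tao2016AveragedNS, §4 Lemma 4.1 (4.8)–(4.10), the viscous equation before Thm. 4.2, §6.4; this file] -/
theorem frequently_largeAction_of_survivingFwd (hε : 0 < ε₀) (hW : IsEternalVisc ε₀ νh α W)
    (hc : IsCancellingCoeff α) (hU : UniformBound W) (hS : EternalSurvivingFwd 1 ε₀ W) {θ : ℝ} (hθ : θ < 1) :
    ∃ᶠ n : ℕ in atTop, θ < (1 + ε₀) * (2 * fluxConst α * (bigLam ε₀)⁻¹ * ∫ σ, ‖W ((n : ℤ) + 1) σ‖) := by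
  by_contra hnot
  rw [Filter.not_frequently] at hnot
  obtain ⟨K, hK⟩ := eventually_atTop.1 hnot
  refine not_survivingFwd_of_eventually_smallAction hε hW hc hU (a := fun n => ∫ σ, ‖W ((n : ℤ) + 1) σ‖)
    (fun n => integral_nonneg fun σ => norm_nonneg _) (fun n => le_rfl) hθ (K := K) ?_ hS
  intro n hn
  exact not_lt.1 (hK n hn)

/-! ## The improved small-action slice -/

/-- **A UNIFORM small action excludes survival with the sharp constant**: `∫‖W_n‖ ≤ M` on every shell and
`(1+ε₀)·2C_AΛ⁻¹M < 1` ⟹ not forward (S₁)-surviving (the small-action rung had `(2+ε₀)` in place of `(1+ε₀)`).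
[cite: Tao2016AveragedNS, §4 Lemma 4.1 (4.8)–(4.10), the viscous equation before Thm. 4.2, §6.4; this file] -/
theorem not_survivingFwd_of_smallAction_sharp (hε : 0 < ε₀) (hW : IsEternalVisc ε₀ νh α W)
    (hc : IsCancellingCoeff α) (hU : UniformBound W) {M : ℝ} (hM : ∀ n, ∫ σ, ‖W n σ‖ ≤ M)
    (hsmall : (1 + ε₀) * (2 * fluxConst α * (bigLam ε₀)⁻¹ * M) < 1) : ¬ EternalSurvivingFwd 1 ε₀ W := by
  have hM0 : 0 ≤ M := le_trans (integral_nonneg fun σ => norm_nonneg (W 0 σ)) (hM 0)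
  exact not_survivingFwd_of_eventually_smallAction hε hW hc hU (a := fun _ => M) (fun _ => hM0)
    (fun n => hM ((n : ℤ) + 1)) hsmall (K := 0) (θ := (1 + ε₀) * (2 * fluxConst α * (bigLam ε₀)⁻¹ * M))
    (fun n _ => le_rfl)

/-- **THE TAIL-SMALL-ACTION SLICE OF K1ᵛ(1).**  For every spread `R`, threshold `εs = 1`: for all `ε₀ ∈ (0,1]`, no table of
`InTableClass R` carries a uniformly bounded admissible eternal solution with covariant viscosity (any `ν̂ ≥ 0`) whose shells
`n ≥ K` (some `K`) all have action `≤ 1/300` and which is forward (S₁)-surviving (`(1+ε₀)·2C_AΛ⁻¹/300 ≤ 256/300 < 1`; the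
first `K` shells are unconstrained).
[cite: Tao2016AveragedNS, §4 Thm. 4.2 (statement shape), Lemma 4.1 (4.8)–(4.10), §6.4; this file] -/
theorem noSurvivingEternalViscBdd_rung_tailSmallAction (R : ℝ) :
    ∀ ε₀ : ℝ, 0 < ε₀ → ε₀ ≤ 1 →
      ∀ α : Fin 4 → Fin 4 → Fin 4 → ℤ × ℤ × ℤ → ℝ, InTableClass R α →
        ∀ (νh : ℝ) (W : ℤ → ℝ → Em 4), IsEternalVisc ε₀ νh α W → UniformBound W →
          (∃ K : ℕ, ∀ n : ℕ, K ≤ n → ∫ σ, ‖W ((n : ℤ) + 1) σ‖ ≤ 1 / 300) → ¬ EternalSurvivingFwd 1 ε₀ W := by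
  intro ε₀ hε₀ hle α hα νh W hW hU ⟨K, hK⟩
  have hC := fluxConst_le_64 hα
  have hC0 := fluxConst_nonneg α
  have hΛ1 : (bigLam ε₀)⁻¹ ≤ 1 := inv_le_one_of_one_le₀ (one_le_bigLam hε₀.le)
  have hΛ0 : 0 ≤ (bigLam ε₀)⁻¹ := inv_nonneg.2 (bigLam_pos (by linarith)).le
  -- bond actions: the true action below `K`, the budget from `K` on
  set a : ℕ → ℝ := fun n => if K ≤ n then 1 / 300 else ∫ σ, ‖W ((n : ℤ) + 1) σ‖ with ha
  have ha0 : ∀ n, 0 ≤ a n := fun n => by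
    by_cases hn : K ≤ n
    · simp only [ha, if_pos hn]; norm_num
    · simp only [ha, if_neg hn]; exact integral_nonneg fun σ => norm_nonneg _
  have hale : ∀ n : ℕ, ∫ σ, ‖W ((n : ℤ) + 1) σ‖ ≤ a n := fun n => by
    by_cases hn : K ≤ n
    · simp only [ha, if_pos hn]; exact hK n hn
    · simp only [ha, if_neg hn]; exact le_rfl
  refine not_survivingFwd_of_eventually_smallAction hε₀ hW hα.2.1 hU ha0 hale (K := K)
    (θ := (1 + 1) * (2 * 64 * 1 * (1 / 300))) (by norm_num) ?_
  intro n hn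
  simp only [ha, if_pos hn]
  have h1 : 2 * fluxConst α * (bigLam ε₀)⁻¹ * (1 / 300) ≤ 2 * 64 * 1 * (1 / 300) := by
    have := mul_le_mul (mul_le_mul_of_nonneg_left hC (by norm_num : (0 : ℝ) ≤ 2)) hΛ1 hΛ0 (by positivity)
    nlinarith
  have h2 : 0 ≤ 2 * fluxConst α * (bigLam ε₀)⁻¹ * (1 / 300) := by positivity
  nlinarith

/-- **Reading for the crux BY NAME**: on a table of `InTableClass R`, every uniformly bounded admissible eternal solution
EXCLUDED by K1ᵛ(1) must in particular — were it to survive — pay action `> θ/(128(1+ε₀))` on infinitely many shells, for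
every `θ < 1` (`2C_AΛ⁻¹ ≤ 128`); this is what `NoSurvivingEternalViscBddOne` asserts cannot be sustained at small `ε₀`.
[cite: Tao2016AveragedNS, §4 Thm. 4.2 (statement shape), §6.4; this file] -/
theorem frequently_action_gt_of_survivingFwd {R : ℝ} (hε : 0 < ε₀) {α : Fin 4 → Fin 4 → Fin 4 → ℤ × ℤ × ℤ → ℝ}
    (hα : InTableClass R α) {νh : ℝ} {W : ℤ → ℝ → Em 4} (hW : IsEternalVisc ε₀ νh α W) (hU : UniformBound W)
    (hS : EternalSurvivingFwd 1 ε₀ W) {θ : ℝ} (hθ : θ < 1) :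
    ∃ᶠ n : ℕ in atTop, θ / (128 * (1 + ε₀)) < ∫ σ, ‖W ((n : ℤ) + 1) σ‖ := by
  have hC := fluxConst_le_64 hα
  have hC0 := fluxConst_nonneg α
  have hΛ1 : (bigLam ε₀)⁻¹ ≤ 1 := inv_le_one_of_one_le₀ (one_le_bigLam hε.le)
  have hΛ0 : 0 ≤ (bigLam ε₀)⁻¹ := inv_nonneg.2 (bigLam_pos (by linarith)).le
  have hl0 : (0 : ℝ) < 1 + ε₀ := by linarith
  refine (frequently_largeAction_of_survivingFwd hε hW hα.2.1 hU hS hθ).mono fun n hn => ?_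
  have hI0 : 0 ≤ ∫ σ, ‖W ((n : ℤ) + 1) σ‖ := integral_nonneg fun σ => norm_nonneg _
  have hk : 2 * fluxConst α * (bigLam ε₀)⁻¹ ≤ 128 := by
    have := mul_le_mul (mul_le_mul_of_nonneg_left hC (by norm_num : (0 : ℝ) ≤ 2)) hΛ1 hΛ0 (by positivity)
    linarith
  have h1 : θ < (1 + ε₀) * (128 * ∫ σ, ‖W ((n : ℤ) + 1) σ‖) := by
    refine hn.trans_le (mul_le_mul_of_nonneg_left ?_ hl0.le)
    exact mul_le_mul_of_nonneg_right hk hI0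
  rw [div_lt_iff₀ (by positivity)]
  linarith

end Summit.NavierStokesRegularity.NavierStokesRegularity.Theorems.NoSurvivingEternalViscBddOne.TailConveyor

end
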